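import Mathlib.Geometry.Manifold.IsManifold.InteriorBoundary
import Mathlib.Geometry.Manifold.Instances.Real
import Mathlib.Geometry.Manifold.SmoothEmbedding
import Mathlib.Geometry.Manifold.Diffeomorph
import Mathlib.Topology.Homotopy.Equiv
import Mathlib.AlgebraicTopology.FundamentalGroupoid.SimplyConnected
import HarnessLib

-- provenance: harness21/H21/H21/Prelude/FourManM/Cobordism.lean @ 4d2e698 (interim HEAD d8f2665); M5 mechanical rewrite
/-!
# Cobordisms and h-cobordisms (trunk T-4MAN, prelude `FourManM`)

Notions `manifold_boundary_as_manifold` and `h_cobordism` of the G18 outline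
(`H21/Outlines/FourManM.md`, §C4, Design 3).

## Informal content

* The boundary `∂M` of a smooth manifold with boundary `M` is itself a smooth manifold (without
  boundary) of one dimension less, smoothly embedded in `M` (Lee, *Introduction to Smooth
  Manifolds* (2013), Ch. 1 and Thm 5.11).
* A *cobordism* between closed `n`-manifolds `M`, `N` is a compact smooth `(n+1)`-manifold with
  boundary `W` together with a decomposition `∂W = M ⊔ N` (Milnor, *Lectures on the h-cobordism
  theorem* (1965), §1; Kervaire–Milnor, *Groups of homotopy spheres I*, Ann. Math. 77 (1963), §1).
* It is an *h-cobordism* if both inclusions `M ↪ W`, `N ↪ W` are homotopy equivalences, and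
  *trivial* if `W ≅ M × [0, 1]` relative to `M`.  A trivial cobordism yields a diffeomorphism
  `M ≅ N`; Freedman (1982): simply connected closed smooth h-cobordant 4-manifolds are homeomorphic.

## Mathlib

Mathlib has the boundary of a manifold with corners only as a *set*
`ModelWithCorners.boundary : Set M` (`Mathlib/Geometry/Manifold/IsManifold/InteriorBoundary.lean`)
with no charted-space structure on it, smooth embeddings `Manifold.IsSmoothEmbedding`
(`SmoothEmbedding.lean`), diffeomorphisms `Diffeomorph` (`≃ₘ⟮I, J⟯`), homotopy equivalences
`ContinuousMap.HomotopyEquiv` (`≃ₕ`), `SimplyConnectedSpace`, and the manifold-with-boundary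
model `𝓡∂ n` on `EuclideanHalfSpace n` together with the `IsManifold (𝓡∂ 1) ω (Set.Icc 0 1)`
instance (`Instances/Real.lean`).  It has no cobordisms (only M. Rothgang's `SingularManifold`
towards bordism groups), no collar theorem and no gluing of manifolds along boundaries.

## Design choices

* Following Rothgang's bordism design, the boundary manifold is **data**: `BoundaryData I M I₀`
  bundles a manifold `carrier` modelled on `I₀` and a smooth embedding onto `I.boundary M`;
  "`∂M` is a manifold" is the existence theorem `nonempty_boundaryData`.
* `Cobordism n M N` bundles the compact Hausdorff second-countable smooth `(n+1)`-manifold with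
  boundary `W` (model `𝓡∂ (n + 1)`) and smooth embeddings `inl : M → W`, `inr : N → W` with
  disjoint ranges covering `∂W`.  No smoothness is imposed on `M`, `N` (only
  `ChartedSpace (𝔼 n)`): if the atlases are not smooth the type is simply empty, and `T2Space`,
  `SecondCountableTopology` of `M`, `N` follow from the embeddings.  Every consumer adds the DIFF
  hypotheses on `M`, `N` (outline, review #13).  Instance-valued fields follow the
  `SingularManifold` pattern (`[inst : …]` + `attribute [instance]`).  `Cobordism.{u}` is universe
  polymorphic (`M N W : Type u`), matching `SingularManifold.{u}`.
* Reflexivity and transitivity of cobordism are theorems with `sorry`: the cylinder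
  `M × Set.Icc 0 1` carries the product model `(𝓡 n).prod (𝓡∂ 1)`, and re-charting it to
  `𝓡∂ (n + 1)`, as well as gluing along boundaries with collars, are absent from Mathlib.
* `IsHomotopyEquiv f` says that the bare function `f` underlies some `ContinuousMap.HomotopyEquiv`.
* Triviality of a cobordism is a diffeomorphism `W ≃ₘ M × [0,1]` sending `inl x` to `(x, 0)`; the
  `N`-end is automatic (see `Cobordism.IsTrivial`).

Manifold conventions and the local notation `𝔼 n` are those of the accepted SPC4 files
(`Statements/SPC4/Wave0.lean`, Mathlib `PoincareConjecture.lean`).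
-/

open scoped Manifold ContDiff Topology ContinuousMap
open Set Function

noncomputable section

namespace Literature.Topology.FourManifolds

universe u

/-- Local notation: `𝔼 n` is the model Euclidean space `EuclideanSpace ℝ (Fin n)`. -/
local notation "𝔼 " n:arg => EuclideanSpace ℝ (Fin n)

/-! ### The boundary of a manifold as a manifold -/

section BoundaryData

variable {E H E₀ H₀ : Type*} [NormedAddCommGroup E] [NormedSpace ℝ E] [TopologicalSpace H]
  [NormedAddCommGroup E₀] [NormedSpace ℝ E₀] [TopologicalSpace H₀]

/-- A *boundary datum* for a charted space `M` modelled on `I`: a smooth manifold `carrier`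
modelled on `I₀` together with a smooth embedding `incl : carrier → M` whose range is exactly the
boundary `I.boundary M`.  This packages "the boundary `∂M` with its induced smooth structure" as
data (Mathlib has `∂M` only as a set); existence for manifolds with boundary is
`Literature.Topology.FourManifolds.nonempty_boundaryData` and uniqueness up to diffeomorphism is
`Literature.Topology.FourManifolds.BoundaryData.nonempty_diffeomorph`.  Lee, *Introduction to Smooth Manifolds* (2013),
Thm 5.11; design of M. Rothgang's `SingularManifold`. [folklore] -/
structure BoundaryData (I : ModelWithCorners ℝ E H) (M : Type u) [TopologicalSpace M]
    [ChartedSpace H M] (I₀ : ModelWithCorners ℝ E₀ H₀) where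
  /-- The boundary manifold. -/
  carrier : Type u
  /-- The topology on the boundary manifold. -/
  [topologicalSpace : TopologicalSpace carrier]
  /-- The atlas on the boundary manifold. -/
  [chartedSpace : ChartedSpace H₀ carrier]
  /-- The boundary manifold is smooth. -/
  [isManifold : IsManifold I₀ ∞ carrier]
  /-- The inclusion of the boundary manifold into `M`. -/
  incl : carrier → M
  /-- The inclusion is a smooth embedding. -/
  isSmoothEmbedding : Manifold.IsSmoothEmbedding I₀ I ∞ incl
  /-- The image of the inclusion is the boundary of `M`. -/
  range_incl : range incl = I.boundary M

attribute [instance] BoundaryData.topologicalSpace BoundaryData.chartedSpace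
  BoundaryData.isManifold

namespace BoundaryData

variable {I : ModelWithCorners ℝ E H} {M : Type u} [TopologicalSpace M] [ChartedSpace H M]
  {I₀ : ModelWithCorners ℝ E₀ H₀}

/-- The inclusion of a boundary datum is continuous (it is a topological embedding). [folklore] -/
theorem continuous_incl (b : BoundaryData I M I₀) : Continuous b.incl :=
  b.isSmoothEmbedding.isEmbedding.continuous

/-- The inclusion of a boundary datum is injective (it is a topological embedding). [folklore] -/
theorem injective_incl (b : BoundaryData I M I₀) : Injective b.incl :=
  b.isSmoothEmbedding.isEmbedding.injective

/-- Every point in the image of the inclusion of a boundary datum is a boundary point. [folklore] -/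
theorem incl_mem_boundary (b : BoundaryData I M I₀) (x : b.carrier) :
    b.incl x ∈ I.boundary M :=
  b.range_incl ▸ mem_range_self x

/-- The boundary datum of a boundaryless manifold is empty
(Mathlib `ModelWithCorners.Boundaryless.boundary_eq_empty`). [folklore] -/
theorem isEmpty_carrier [BoundarylessManifold I M] (b : BoundaryData I M I₀) :
    IsEmpty b.carrier :=
  ⟨fun x => by simpa [ModelWithCorners.Boundaryless.boundary_eq_empty] using
    b.incl_mem_boundary x⟩

/-- The boundary manifold of a compact `C¹` manifold is compact: the boundary is closed
(Mathlib `ModelWithCorners.isClosed_boundary`) and `incl` is an embedding onto it.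
Lee, *Introduction to Smooth Manifolds* (2013), Prop. 5.46 ff. [folklore] -/
theorem compactSpace_carrier [IsManifold I 1 M] [CompactSpace M] (b : BoundaryData I M I₀) :
    CompactSpace b.carrier := by
  refine ⟨b.isSmoothEmbedding.isEmbedding.isCompact_iff.mpr ?_⟩
  rw [image_univ, b.range_incl]
  exact (ModelWithCorners.isClosed_boundary (I := I) (M := M) (n := 1) one_ne_zero).isCompact

/-- Any two boundary data of the same manifold are diffeomorphic: both are smooth embeddings
onto the same subset `∂M`, and `b'.incl⁻¹ ∘ b.incl` is smooth (boundary charts restrict to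
charts of the boundary).  Lee, *Introduction to Smooth Manifolds* (2013), Thm 5.11 and
Prop. 5.51 (uniqueness of the smooth structure on an embedded submanifold). [cite: LeeSmoothManifolds2013, Thm. 5.11 and Prop. 5.51] -/
def nonempty_diffeomorph : Prop :=
  ∀ (b b' : BoundaryData I M I₀),
    Nonempty (b.carrier ≃ₘ⟮I₀, I₀⟯ b'.carrier)

end BoundaryData

/-- **The boundary of a manifold with boundary is a manifold.**  For a smooth
`(n+1)`-manifold with boundary `W` (model `𝓡∂ (n + 1)`), the boundary `∂W` carries the structure
of a smooth `n`-manifold without boundary (model `𝓡 n`) for which the inclusion is a smooth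
embedding with image `(𝓡∂ (n + 1)).boundary W`.  Lee, *Introduction to Smooth Manifolds* (2013),
Thm 1.46/Thm 5.11 (standard); absent from Mathlib. [cite: LeeSmoothManifolds2013, Thm. 1.46 and Thm. 5.11] -/
def nonempty_boundaryData : Prop :=
  ∀ (n : ℕ) (W : Type u) [TopologicalSpace W] [T2Space W] [SecondCountableTopology W] [ChartedSpace (EuclideanHalfSpace (n + 1)) W] [IsManifold (𝓡∂ (n + 1)) ∞ W],
    Nonempty (BoundaryData (𝓡∂ (n + 1)) W (𝓡 n))

end BoundaryData

/-! ### Cobordisms -/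

/-- A (smooth, unoriented) *cobordism* between `n`-dimensional charted spaces `M` and `N`:
a compact Hausdorff second-countable smooth `(n+1)`-manifold with boundary `W` (model
`𝓡∂ (n + 1)`) together with smooth embeddings `inl : M → W`, `inr : N → W` with disjoint ranges
whose union is the boundary `∂W`.  Milnor, *Lectures on the h-cobordism theorem* (1965), §1
(Def. 1.1, with the identifications `∂W ≅ M ⊔ N` made part of the data); Kervaire–Milnor,
Ann. Math. 77 (1963), §1.

No smoothness is imposed on `M`, `N` (only `ChartedSpace (𝔼 n)`): for non-smooth atlases the type
is simply empty, and `T2Space`/`SecondCountableTopology`/`CompactSpace` of `M`, `N` follow from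
the embeddings into the compact Hausdorff `W`.  Every consumer adds the DIFF hypotheses on `M`, `N`. [folklore] -/
structure Cobordism (n : ℕ) (M N : Type u) [TopologicalSpace M] [ChartedSpace (𝔼 n) M]
    [TopologicalSpace N] [ChartedSpace (𝔼 n) N] where
  /-- The total space of the cobordism, an `(n+1)`-manifold with boundary. -/
  W : Type u
  /-- The topology on `W`. -/
  [topologicalSpace : TopologicalSpace W]
  /-- `W` is Hausdorff. -/
  [t2Space : T2Space W]
  /-- `W` is second countable. -/
  [secondCountableTopology : SecondCountableTopology W]
  /-- The atlas of `W`, modelled on the half-space `EuclideanHalfSpace (n + 1)`. -/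
  [chartedSpace : ChartedSpace (EuclideanHalfSpace (n + 1)) W]
  /-- `W` is a smooth manifold with boundary. -/
  [isManifold : IsManifold (𝓡∂ (n + 1)) ∞ W]
  /-- `W` is compact. -/
  [compactSpace : CompactSpace W]
  /-- The inclusion of the incoming boundary `M`. -/
  inl : M → W
  /-- The inclusion of the outgoing boundary `N`. -/
  inr : N → W
  /-- `inl` is a smooth embedding. -/
  isSmoothEmbedding_inl : Manifold.IsSmoothEmbedding (𝓡 n) (𝓡∂ (n + 1)) ∞ inl
  /-- `inr` is a smooth embedding. -/
  isSmoothEmbedding_inr : Manifold.IsSmoothEmbedding (𝓡 n) (𝓡∂ (n + 1)) ∞ inr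
  /-- The two boundary pieces are disjoint. -/
  disjoint_range : Disjoint (range inl) (range inr)
  /-- The two boundary pieces cover the boundary of `W`. -/
  range_inl_union_range_inr : range inl ∪ range inr = (𝓡∂ (n + 1)).boundary W

attribute [instance] Cobordism.topologicalSpace Cobordism.t2Space Cobordism.secondCountableTopology
  Cobordism.chartedSpace Cobordism.isManifold Cobordism.compactSpace

section Cobordism

variable {n : ℕ} {M N P : Type u} [TopologicalSpace M] [ChartedSpace (𝔼 n) M]
  [TopologicalSpace N] [ChartedSpace (𝔼 n) N] [TopologicalSpace P] [ChartedSpace (𝔼 n) P]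

namespace Cobordism

/-- The reversed cobordism, from `N` to `M`, with the same total space (Milnor 1965, §1). [cite: Milnor1965, §1] -/
@[simps W inl inr]
def symm (c : Cobordism n M N) : Cobordism n N M where
  W := c.W
  inl := c.inr
  inr := c.inl
  isSmoothEmbedding_inl := c.isSmoothEmbedding_inr
  isSmoothEmbedding_inr := c.isSmoothEmbedding_inl
  disjoint_range := c.disjoint_range.symm
  range_inl_union_range_inr := by rw [union_comm]; exact c.range_inl_union_range_inr

/-- The incoming boundary lands in `∂W` (Milnor 1965, §1). [cite: Milnor1965, §1] -/
theorem inl_mem_boundary (c : Cobordism n M N) (x : M) :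
    c.inl x ∈ (𝓡∂ (n + 1)).boundary c.W :=
  c.range_inl_union_range_inr ▸ Or.inl (mem_range_self x)

/-- The outgoing boundary lands in `∂W` (Milnor 1965, §1). [cite: Milnor1965, §1] -/
theorem inr_mem_boundary (c : Cobordism n M N) (y : N) :
    c.inr y ∈ (𝓡∂ (n + 1)).boundary c.W :=
  c.range_inl_union_range_inr ▸ Or.inr (mem_range_self y)

/-- `inl` is continuous (it is a smooth embedding). [folklore] -/
theorem continuous_inl (c : Cobordism n M N) : Continuous c.inl :=
  c.isSmoothEmbedding_inl.isEmbedding.continuous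

/-- `inr` is continuous (it is a smooth embedding). [folklore] -/
theorem continuous_inr (c : Cobordism n M N) : Continuous c.inr :=
  c.isSmoothEmbedding_inr.isEmbedding.continuous

/-- The corestriction of `inl` to a continuous map into the boundary `∂W` (used to push
fundamental classes into `H_n(∂W)`; Milnor 1965, §1). [cite: Milnor1965, §1] -/
def inlBoundary (c : Cobordism n M N) : C(M, ↥((𝓡∂ (n + 1)).boundary c.W)) where
  toFun x := ⟨c.inl x, c.inl_mem_boundary x⟩
  continuous_toFun := c.continuous_inl.subtype_mk _

/-- The corestriction of `inr` to a continuous map into the boundary `∂W` (Milnor 1965, §1). [cite: Milnor1965, §1] -/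
def inrBoundary (c : Cobordism n M N) : C(N, ↥((𝓡∂ (n + 1)).boundary c.W)) where
  toFun y := ⟨c.inr y, c.inr_mem_boundary y⟩
  continuous_toFun := c.continuous_inr.subtype_mk _

/-- `inlBoundary` is `inl` followed by the subtype coercion. [folklore] -/
@[simp]
theorem coe_inlBoundary_apply (c : Cobordism n M N) (x : M) : (c.inlBoundary x : c.W) = c.inl x :=
  rfl

/-- `inrBoundary` is `inr` followed by the subtype coercion. [folklore] -/
@[simp]
theorem coe_inrBoundary_apply (c : Cobordism n M N) (y : N) : (c.inrBoundary y : c.W) = c.inr y :=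
  rfl

end Cobordism

/-- `M` and `N` are (smoothly, unorientedly) *cobordant* if there is a cobordism between them:
the cobordism RELATION on `n`-dimensional charted spaces — a predicate in `n`, `M`, `N` (written
with explicit binders so that it reads as one), not a statement.  Symmetry and (as named facts)
reflexivity on closed smooth manifolds and transitivity: `IsCobordant.symm`, `isCobordant_refl`,
`IsCobordant.trans`.  Milnor, *Lectures on the h-cobordism theorem* (1965), §1; Thom (1954).
[cite: Thom1954] -/
def IsCobordant (n : ℕ) (M N : Type u) [TopologicalSpace M] [ChartedSpace (𝔼 n) M]
    [TopologicalSpace N] [ChartedSpace (𝔼 n) N] : Prop :=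
  Nonempty (Cobordism n M N)

/-- Cobordism is reflexive on closed smooth manifolds: the cylinder `M × [0, 1]` is a cobordism
from `M` to `M` (Milnor 1965, §1).  `sorry`: in Mathlib the cylinder `M × Set.Icc 0 1` carries the
product model `(𝓡 n).prod (𝓡∂ 1)`; re-charting it as an `IsManifold (𝓡∂ (n + 1)) ∞` manifold
(and identifying its boundary with `M × {0, 1}`) is absent from Mathlib. [cite: Milnor1965, §1] -/
def isCobordant_refl : Prop :=
  ∀ [T2Space M] [SecondCountableTopology M] [IsManifold (𝓡 n) ∞ M] [CompactSpace M],
    IsCobordant n M M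

/-- Cobordism is symmetric (reverse the cobordism; Milnor 1965, §1). [cite: Milnor1965, §1] -/
theorem IsCobordant.symm (h : IsCobordant n M N) : IsCobordant n N M :=
  h.map Cobordism.symm

variable (n M N) in
/-- Cobordism is symmetric, `iff` form. [folklore] -/
theorem isCobordant_comm : IsCobordant n M N ↔ IsCobordant n N M :=
  ⟨IsCobordant.symm, IsCobordant.symm⟩

/-- Cobordism is transitive: glue two cobordisms along the common boundary `N` using collars
(Milnor 1965, Thm 1.4 and §1).  `sorry`: the collar neighbourhood theorem and gluing of smooth
manifolds along boundary components are absent from Mathlib. [cite: Milnor1965, Thm 1.4 and §1] -/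
def IsCobordant.trans : Prop :=
  ∀ (h₁ : IsCobordant n M N) (h₂ : IsCobordant n N P),
    IsCobordant n M P

/-! ### h-cobordisms -/

/-- A map `f : X → Y` between topological spaces *is a homotopy equivalence* if it underlies some
`ContinuousMap.HomotopyEquiv X Y` (Mathlib bundles homotopy equivalences; this is the predicate on
bare functions).  Hatcher, *Algebraic Topology* (2002), §0. [folklore] -/
def IsHomotopyEquiv {X Y : Type*} [TopologicalSpace X] [TopologicalSpace Y] (f : X → Y) : Prop :=
  ∃ e : X ≃ₕ Y, ⇑e.toFun = f

/-- A homotopy equivalence in the sense of `IsHomotopyEquiv` is continuous. [folklore] -/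
theorem IsHomotopyEquiv.continuous {X Y : Type*} [TopologicalSpace X] [TopologicalSpace Y]
    {f : X → Y} (hf : IsHomotopyEquiv f) : Continuous f := by
  obtain ⟨e, rfl⟩ := hf
  exact e.toFun.continuous

/-- The map underlying a homeomorphism is a homotopy equivalence
(Mathlib `Homeomorph.toHomotopyEquiv`). [folklore] -/
theorem _root_.Homeomorph.isHomotopyEquiv {X Y : Type*} [TopologicalSpace X]
    [TopologicalSpace Y] (e : X ≃ₜ Y) : IsHomotopyEquiv (⇑e) :=
  ⟨e.toHomotopyEquiv, rfl⟩

/-- The identity is a homotopy equivalence. [folklore] -/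
theorem IsHomotopyEquiv.id (X : Type*) [TopologicalSpace X] : IsHomotopyEquiv (id : X → X) :=
  (Homeomorph.refl X).isHomotopyEquiv

namespace Cobordism

/-- A cobordism is an *h-cobordism* if both boundary inclusions `M ↪ W` and `N ↪ W` are homotopy
equivalences.  Milnor, *Lectures on the h-cobordism theorem* (1965), §1 (p. 2); Kervaire–Milnor,
Ann. Math. 77 (1963), §1. [folklore] -/
def IsHCobordism (c : Cobordism n M N) : Prop :=
  IsHomotopyEquiv c.inl ∧ IsHomotopyEquiv c.inr

/-- The reverse of an h-cobordism is an h-cobordism. [folklore] -/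
theorem IsHCobordism.symm {c : Cobordism n M N} (h : c.IsHCobordism) : c.symm.IsHCobordism :=
  ⟨h.2, h.1⟩

/-- Reversing a cobordism preserves and reflects being an h-cobordism. [folklore] -/
@[simp]
theorem isHCobordism_symm_iff (c : Cobordism n M N) : c.symm.IsHCobordism ↔ c.IsHCobordism :=
  ⟨fun h => ⟨h.2, h.1⟩, IsHCobordism.symm⟩

/-- A cobordism `W` from `M` to `N` is *trivial* (a product cobordism) if there is a
diffeomorphism `Φ : W ≅ M × [0, 1]` with `Φ (inl x) = (x, 0)` for all `x : M`.  Milnor,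
*Lectures on the h-cobordism theorem* (1965), §1 and Thm 9.1.  The `N`-end is automatic: `Φ` maps
`∂W = inl M ⊔ inr N` onto `∂(M × [0,1]) = M × {0, 1}`, so `Φ ∘ inr` is a diffeomorphism onto
`M × {1}` (see `Literature.Topology.FourManifolds.Cobordism.nonempty_diffeomorph_of_isTrivial`).  The cylinder carries
Mathlib's product model `(𝓡 n).prod (𝓡∂ 1)`. [folklore] -/
def IsTrivial (c : Cobordism n M N) : Prop :=
  ∃ Φ : c.W ≃ₘ^∞⟮𝓡∂ (n + 1), (𝓡 n).prod (𝓡∂ 1)⟯ (M × (Set.Icc (0 : ℝ) 1)),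
    ∀ x, Φ (c.inl x) = (x, ⊥)

end Cobordism

/-- `M` and `N` are *h-cobordant* if there is an h-cobordism between them: the h-cobordism
RELATION on `n`-dimensional charted spaces — a predicate in `n`, `M`, `N` (written with explicit
binders so that it reads as one), not a statement: its universal closure fails
(`Literature.Topology.FourManifolds.not_isHCobordant_of_isEmpty` below).  Symmetry and (as named
facts) reflexivity on closed smooth manifolds and transitivity: `IsHCobordant.symm`,
`isHCobordant_refl`, `IsHCobordant.trans`.  Milnor, *Lectures on the h-cobordism theorem* (1965),
§1; Kervaire–Milnor, Ann. Math. 77 (1963), §1. [folklore] -/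
def IsHCobordant (n : ℕ) (M N : Type u) [TopologicalSpace M] [ChartedSpace (𝔼 n) M]
    [TopologicalSpace N] [ChartedSpace (𝔼 n) N] : Prop :=
  ∃ c : Cobordism n M N, c.IsHCobordism

/-- h-cobordant manifolds are cobordant. [folklore] -/
theorem IsHCobordant.isCobordant (h : IsHCobordant n M N) : IsCobordant n M N :=
  h.elim fun c _ => ⟨c⟩

/-- h-cobordism is symmetric (reverse the h-cobordism; Kervaire–Milnor 1963, §1). [cite: KervaireMilnor1963, §1] -/
theorem IsHCobordant.symm (h : IsHCobordant n M N) : IsHCobordant n N M :=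
  h.elim fun c hc => ⟨c.symm, hc.symm⟩

variable (n M N) in
/-- h-cobordism is symmetric, `iff` form. [folklore] -/
theorem isHCobordant_comm : IsHCobordant n M N ↔ IsHCobordant n N M :=
  ⟨IsHCobordant.symm, IsHCobordant.symm⟩

/-- h-cobordism is reflexive on closed smooth manifolds: the cylinder `M × [0, 1]` is an
h-cobordism (Kervaire–Milnor 1963, §1).  `sorry`: see `Literature.Topology.FourManifolds.isCobordant_refl` (re-charting the
cylinder to the model `𝓡∂ (n + 1)` is absent from Mathlib). [cite: KervaireMilnor1963, §1] -/
def isHCobordant_refl : Prop :=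
  ∀ [T2Space M] [SecondCountableTopology M] [IsManifold (𝓡 n) ∞ M] [CompactSpace M],
    IsHCobordant n M M

/-- h-cobordism is transitive: the composite of two h-cobordisms glued along `N` is an
h-cobordism (Kervaire–Milnor 1963, Lemma 1.1 ff.).  `sorry`: gluing along boundaries (collars) is
absent from Mathlib. [cite: KervaireMilnor1963, Lemma 1.1 ff] -/
def IsHCobordant.trans : Prop :=
  ∀ (h₁ : IsHCobordant n M N) (h₂ : IsHCobordant n N P),
    IsHCobordant n M P

/-- A trivial cobordism between closed smooth manifolds yields a diffeomorphism of its ends: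
if `Φ : W ≅ M × [0,1]` sends `inl M` to `M × {0}`, then `Φ ∘ inr` is a diffeomorphism of `N` onto
`M × {1} ≅ M`.  Milnor, *Lectures on the h-cobordism theorem* (1965), §1 and proof of Thm 9.1. [cite: MilnorHCobordism1965, §1 and proof of Thm. 9.1] -/
def Cobordism.nonempty_diffeomorph_of_isTrivial : Prop :=
  ∀ [T2Space M] [SecondCountableTopology M] [IsManifold (𝓡 n) ∞ M] [CompactSpace M] [T2Space N] [SecondCountableTopology N] [IsManifold (𝓡 n) ∞ N] [CompactSpace N] (c : Cobordism n M N) (h : c.IsTrivial),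
    Nonempty (M ≃ₘ⟮𝓡 n, 𝓡 n⟯ N)

/-- **Freedman's h-cobordism theorem in dimension 4 (topological conclusion).**  Simply connected
closed smooth 4-manifolds that are (smoothly) h-cobordant are homeomorphic.  Freedman, *The
topology of four-dimensional manifolds*, J. Diff. Geom. 17 (1982), Thm 1.3 (5-dimensional
TOP h-cobordism theorem); Freedman–Quinn, *Topology of 4-manifolds* (1990), Thm 7.1A.  Simple
connectivity is assumed on `M` only: `N ≃ₕ W ≃ₕ M` is then simply connected as well. [cite: FreedmanJDG1982, Thm. 1.3; Freedman–Quinn Thm. 7.1A] -/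
def nonempty_homeomorph_of_isHCobordant_four : Prop :=
  ∀ {M N : Type u} [TopologicalSpace M] [T2Space M] [SecondCountableTopology M] [ChartedSpace (𝔼 4) M] [IsManifold (𝓡 4) ∞ M] [CompactSpace M] [SimplyConnectedSpace M] [TopologicalSpace N] [T2Space N] [SecondCountableTopology N] [ChartedSpace (𝔼 4) N] [IsManifold (𝓡 4) ∞ N] [CompactSpace N] (h : IsHCobordant 4 M N),
    Nonempty (M ≃ₜ N)

/-- The ends of an h-cobordism are simultaneously empty or nonempty: `M ≃ₕ W ≃ₕ N`, and homotopy
equivalent spaces are simultaneously (non)empty.  In particular `IsHCobordant n M N` is a genuine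
relation on `M`, `N` (a notion, not a universally valid statement); Kervaire–Milnor,
Ann. Math. 77 (1963), §1. [folklore] -/
theorem IsHCobordant.nonempty_iff (h : IsHCobordant n M N) : Nonempty M ↔ Nonempty N := by
  obtain ⟨c, ⟨eM, -⟩, ⟨eN, -⟩⟩ := h
  exact ⟨fun ⟨x⟩ => ⟨eN.invFun (eM.toFun x)⟩, fun ⟨y⟩ => ⟨eM.invFun (eN.toFun y)⟩⟩

/-- A nonempty space is not h-cobordant to an empty one (so `∀ M N, IsHCobordant n M N` fails:
`IsHCobordant` is a definition, not a fact). [folklore] -/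
theorem not_isHCobordant_of_isEmpty [Nonempty M] [IsEmpty N] : ¬ IsHCobordant n M N :=
  fun h => not_nonempty_iff.mpr ‹IsEmpty N› (h.nonempty_iff.mp ‹Nonempty M›)

end Cobordism

end Literature.Topology.FourManifolds

/-! ## Discharge of `Literature.Topology.FourManifolds.nonempty_boundaryData`: the boundary `∂W` as a smooth manifold

Lee, *Introduction to Smooth Manifolds* (2nd ed., 2013), Thm 5.11 (p. 120): *if `M` is a smooth
`n`-manifold with boundary, then with the subspace topology `∂M` is a topological
`(n-1)`-manifold (without boundary), and has a smooth structure such that it is a properly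
embedded submanifold of `M`* (proof: Problem 5-2 — the boundary charts of `M` restrict to
charts of `∂M` and are slice charts for `∂M` in `M`).  That a boundary chart sends `∂M ∩ U`
exactly onto `φ(U) ∩ ∂ℍⁿ` is the smooth invariance of the boundary (Lee, Thm 1.46), which
Mathlib proves for `C¹` manifolds (`ModelWithCorners.isInteriorPoint_iff_of_mem_atlas`).

Implementation (namespace `Literature.BoundaryManifold`), for `W` a `C^∞` manifold with boundary
modelled on `𝓡∂ (n + 1)`:
* `consCLE n : (𝔼 n × ℝ) ≃L[ℝ] 𝔼 (n + 1)`, `(u, t) ↦ (t, u)`, with `tail n` (drop the first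
  coordinate) and `toHalfSpace n : 𝔼 n → EuclideanHalfSpace (n + 1)`, `u ↦ (0, u)`;
* `mem_boundary_iff_of_mem_atlas`: `x ∈ ∂W ↔ (e x) 0 = 0` for any chart `e ∋ x` (Thm 1.46);
* `boundaryChart p`: the chart `tail ∘ chartAt p.1 ∘ Subtype.val` of the subtype `∂W` at `p`,
  giving instances `ChartedSpace (𝔼 n) ∂W` and `IsManifold (𝓡 n) ∞ ∂W` (transition maps are
  `tail ∘ (transition map of W) ∘ toHalfSpace`, smooth by `contDiffOn_extendCoordChange`);
* `isSmoothEmbedding_subtype_val`: `Subtype.val : ∂W → W` is a smooth embedding — in the charts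
  `boundaryChart x`, `chartAt x.1` it reads `u ↦ consCLE n (u, 0)`
  (`Manifold.IsImmersionAtOfComplement.mk_of_continuousAt` with complement `ℝ`).
`nonempty_boundaryData_holds` packages the subtype `∂W` with this structure as a `BoundaryData`.
-/

namespace Literature.Topology.FourManifolds

universe u

/-- Local notation: `𝔼 n` is the model Euclidean space `EuclideanSpace ℝ (Fin n)`. -/
local notation "𝔼 " n:arg => EuclideanSpace ℝ (Fin n)

namespace BoundaryManifold

/-! ### Linear algebra: `ℝⁿ⁺¹ ≅ ℝⁿ × ℝ`, splitting off the first coordinate -/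

/-- The continuous linear isomorphism `ℝⁿ × ℝ ≅ ℝⁿ⁺¹`, `(u, t) ↦ (t, u₀, …, uₙ₋₁)` (`Fin.cons`
transported to `EuclideanSpace`); the first coordinate of `ℝⁿ⁺¹` is the one defining the
half-space `EuclideanHalfSpace (n + 1) = {x | 0 ≤ x 0}`. [folklore] -/
def consCLE (n : ℕ) : (𝔼 n × ℝ) ≃L[ℝ] 𝔼 (n + 1) :=
  (ContinuousLinearEquiv.prodComm ℝ (𝔼 n) ℝ).trans <|
    ((ContinuousLinearEquiv.refl ℝ ℝ).prodCongr
        (PiLp.continuousLinearEquiv 2 ℝ (fun _ : Fin n => ℝ))).trans <|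
      (Fin.consEquivL ℝ (fun _ : Fin (n + 1) => ℝ)).trans
        (PiLp.continuousLinearEquiv 2 ℝ (fun _ : Fin (n + 1) => ℝ)).symm

/-- The first coordinate of `consCLE n (u, t)` is `t`. [folklore] -/
@[simp]
theorem consCLE_apply_zero (n : ℕ) (p : 𝔼 n × ℝ) : consCLE n p 0 = p.2 := rfl

/-- The later coordinates of `consCLE n (u, t)` are those of `u`. [folklore] -/
@[simp]
theorem consCLE_apply_succ (n : ℕ) (p : 𝔼 n × ℝ) (i : Fin n) :
    consCLE n p i.succ = p.1 i := rfl

/-- The `ℝ`-component of `(consCLE n).symm x` is the first coordinate `x 0`. [folklore] -/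
@[simp]
theorem consCLE_symm_apply_snd (n : ℕ) (x : 𝔼 (n + 1)) : ((consCLE n).symm x).2 = x 0 := rfl

/-- The `ℝⁿ`-component of `(consCLE n).symm x` is the tail of `x`. [folklore] -/
@[simp]
theorem consCLE_symm_apply_fst_apply (n : ℕ) (x : 𝔼 (n + 1)) (i : Fin n) :
    ((consCLE n).symm x).1 i = x i.succ := rfl

/-- Dropping the first coordinate, `ℝⁿ⁺¹ → ℝⁿ`. [folklore] -/
def tail (n : ℕ) (x : 𝔼 (n + 1)) : 𝔼 n := ((consCLE n).symm x).1

/-- The inclusion `u ↦ (0, u)` of `ℝⁿ` onto the boundary hyperplane `∂ℍⁿ⁺¹ = {x | x 0 = 0}` of the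
half-space `EuclideanHalfSpace (n + 1)`. [folklore] -/
def toHalfSpace (n : ℕ) (u : 𝔼 n) : EuclideanHalfSpace (n + 1) :=
  ⟨consCLE n (u, 0), (consCLE_apply_zero n (u, 0)).ge⟩

/-- `toHalfSpace n u` is the vector `consCLE n (u, 0)`. [folklore] -/
@[simp]
theorem toHalfSpace_val (n : ℕ) (u : 𝔼 n) : (toHalfSpace n u).val = consCLE n (u, 0) := rfl

/-- `tail` is left inverse to `consCLE`. [folklore] -/
@[simp]
theorem tail_consCLE (n : ℕ) (p : 𝔼 n × ℝ) : tail n (consCLE n p) = p.1 := by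
  simp [tail]

/-- A vector is recovered from its tail and its first coordinate. [folklore] -/
theorem consCLE_tail (n : ℕ) (x : 𝔼 (n + 1)) : consCLE n (tail n x, x 0) = x := by
  rw [tail, ← consCLE_symm_apply_snd, Prod.mk.eta, ContinuousLinearEquiv.apply_symm_apply]

/-- A vector with vanishing first coordinate is recovered from its tail. [folklore] -/
theorem consCLE_tail_of_eq_zero (n : ℕ) {x : 𝔼 (n + 1)} (hx : x 0 = 0) :
    consCLE n (tail n x, 0) = x := by
  rw [← hx, consCLE_tail]

/-- The model with corners `𝓡∂ (n + 1)` inverts `toHalfSpace` on the boundary hyperplane.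
[folklore] -/
theorem modelWithCorners_symm_consCLE (n : ℕ) (u : 𝔼 n) :
    (𝓡∂ (n + 1)).symm (consCLE n (u, 0)) = toHalfSpace n u :=
  (𝓡∂ (n + 1)).left_inv (toHalfSpace n u)

/-- `tail` is continuous. [folklore] -/
theorem continuous_tail (n : ℕ) : Continuous (tail n) :=
  continuous_fst.comp (consCLE n).symm.continuous

/-- `tail` is smooth. [folklore] -/
theorem contDiff_tail (n : ℕ) : ContDiff ℝ ∞ (tail n) :=
  contDiff_fst.comp (consCLE n).symm.contDiff

/-- `u ↦ consCLE n (u, 0)` is smooth. [folklore] -/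
theorem contDiff_consCLE_zero (n : ℕ) : ContDiff ℝ ∞ (fun u : 𝔼 n => consCLE n (u, 0)) :=
  (consCLE n).contDiff.comp (contDiff_id.prodMk contDiff_const)

/-- `toHalfSpace` is continuous. [folklore] -/
theorem continuous_toHalfSpace (n : ℕ) : Continuous (toHalfSpace n) :=
  (contDiff_consCLE_zero n).continuous.subtype_mk _

/-! ### Boundary charts -/

section charts

variable {n : ℕ} {W : Type u} [TopologicalSpace W] [ChartedSpace (EuclideanHalfSpace (n + 1)) W]

/-- **Smooth invariance of the boundary**, chart form: a point of a `C¹` manifold with boundary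
lies on `∂W` iff any given chart around it maps it to the boundary hyperplane `{x | x 0 = 0}`.
Lee, *Introduction to Smooth Manifolds* (2013), Thm 1.46; Mathlib
`ModelWithCorners.isInteriorPoint_iff_of_mem_atlas`. [cite: LeeSmoothManifolds2013, Thm. 1.46] -/
theorem mem_boundary_iff_of_mem_atlas [IsManifold (𝓡∂ (n + 1)) 1 W]
    {e : OpenPartialHomeomorph W (EuclideanHalfSpace (n + 1))}
    (he : e ∈ atlas (EuclideanHalfSpace (n + 1)) W) {x : W} (hx : x ∈ e.source) :
    x ∈ (𝓡∂ (n + 1)).boundary W ↔ (e x).val 0 = 0 := by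
  change (𝓡∂ (n + 1)).IsBoundaryPoint x ↔ _
  rw [ModelWithCorners.isBoundaryPoint_iff_not_isInteriorPoint,
    (𝓡∂ (n + 1)).isInteriorPoint_iff_of_mem_atlas (n := 1) one_ne_zero he hx]
  have h1 : e.extend (𝓡∂ (n + 1)) x = (e x).val := rfl
  constructor
  · intro h
    by_contra hne
    apply h
    apply e.mem_interior_extend_target (e.map_source hx)
    rw [interior_range_modelWithCornersEuclideanHalfSpace]
    exact lt_of_le_of_ne (e x).2 (Ne.symm hne)
  · intro h hint
    have := e.interior_extend_target_subset_interior_range hint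
    rw [interior_range_modelWithCornersEuclideanHalfSpace, mem_setOf_eq, h1, h] at this
    exact lt_irrefl _ this

variable [IsManifold (𝓡∂ (n + 1)) ∞ W]

/-- A chart of `W` pulls the boundary hyperplane back into `∂W`.
[cite: LeeSmoothManifolds2013, Thm. 1.46] -/
theorem symm_toHalfSpace_mem_boundary {e : OpenPartialHomeomorph W (EuclideanHalfSpace (n + 1))}
    (he : e ∈ atlas (EuclideanHalfSpace (n + 1)) W) {u : 𝔼 n}
    (hu : toHalfSpace n u ∈ e.target) : e.symm (toHalfSpace n u) ∈ (𝓡∂ (n + 1)).boundary W := by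
  rw [mem_boundary_iff_of_mem_atlas he (e.map_target hu), e.right_inv hu]
  rfl

/-- On `∂W` a chart of `W` is determined by its tail. [cite: LeeSmoothManifolds2013, Thm. 1.46] -/
theorem toHalfSpace_tail_chart {e : OpenPartialHomeomorph W (EuclideanHalfSpace (n + 1))}
    (he : e ∈ atlas (EuclideanHalfSpace (n + 1)) W) {x : W} (hx : x ∈ e.source)
    (hxb : x ∈ (𝓡∂ (n + 1)).boundary W) : toHalfSpace n (tail n (e x).val) = e x := by
  ext1
  exact consCLE_tail_of_eq_zero n ((mem_boundary_iff_of_mem_atlas he hx).1 hxb)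

open Classical in
/-- The chart of `∂W` around `p ∈ ∂W`: the chart of `W` at `p` restricted to `∂W`, followed by
dropping the first coordinate (which vanishes on `∂W`); its inverse is `u ↦ (chartAt p)⁻¹ (0, u)`
on the target (and the junk value `p` elsewhere).  Lee, *Introduction to Smooth Manifolds* (2013),
proof of Thm 5.11 (Problem 5-2). [cite: LeeSmoothManifolds2013, Thm. 5.11] -/
def boundaryChart (p : (𝓡∂ (n + 1)).boundary W) :
    OpenPartialHomeomorph ((𝓡∂ (n + 1)).boundary W) (𝔼 n) where
  source := Subtype.val ⁻¹' (chartAt (EuclideanHalfSpace (n + 1)) p.1).source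
  target := toHalfSpace n ⁻¹' (chartAt (EuclideanHalfSpace (n + 1)) p.1).target
  toFun q := tail n (chartAt (EuclideanHalfSpace (n + 1)) p.1 q.1).val
  invFun u :=
    if h : toHalfSpace n u ∈ (chartAt (EuclideanHalfSpace (n + 1)) p.1).target then
      ⟨(chartAt (EuclideanHalfSpace (n + 1)) p.1).symm (toHalfSpace n u),
        symm_toHalfSpace_mem_boundary (chart_mem_atlas (EuclideanHalfSpace (n + 1)) p.1) h⟩
    else p
  map_source' q hq := by
    simp only [mem_preimage] at hq ⊢
    rw [toHalfSpace_tail_chart (chart_mem_atlas (EuclideanHalfSpace (n + 1)) p.1) hq q.2]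
    exact (chartAt (EuclideanHalfSpace (n + 1)) p.1).map_source hq
  map_target' u hu := by
    simp only [mem_preimage] at hu
    simp only [hu, ↓reduceDIte, mem_preimage]
    exact (chartAt (EuclideanHalfSpace (n + 1)) p.1).map_target hu
  left_inv' q hq := by
    simp only [mem_preimage] at hq
    have h1 := toHalfSpace_tail_chart (chart_mem_atlas (EuclideanHalfSpace (n + 1)) p.1) hq q.2
    have h2 : toHalfSpace n (tail n (chartAt (EuclideanHalfSpace (n + 1)) p.1 q.1).val) ∈
        (chartAt (EuclideanHalfSpace (n + 1)) p.1).target := by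
      rw [h1]
      exact (chartAt (EuclideanHalfSpace (n + 1)) p.1).map_source hq
    simp only [h2, ↓reduceDIte]
    ext1
    simp only [h1]
    exact (chartAt (EuclideanHalfSpace (n + 1)) p.1).left_inv hq
  right_inv' u hu := by
    simp only [mem_preimage] at hu
    simp only [hu, ↓reduceDIte]
    rw [(chartAt (EuclideanHalfSpace (n + 1)) p.1).right_inv hu, toHalfSpace_val, tail_consCLE]
  open_source :=
    (chartAt (EuclideanHalfSpace (n + 1)) p.1).open_source.preimage continuous_subtype_val
  open_target :=
    (chartAt (EuclideanHalfSpace (n + 1)) p.1).open_target.preimage (continuous_toHalfSpace n)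
  continuousOn_toFun := by
    refine (continuous_tail n).comp_continuousOn (continuous_subtype_val.comp_continuousOn ?_)
    exact (chartAt (EuclideanHalfSpace (n + 1)) p.1).continuousOn.comp
      continuous_subtype_val.continuousOn fun q hq => hq
  continuousOn_invFun := by
    rw [Topology.IsInducing.subtypeVal.continuousOn_iff]
    refine ContinuousOn.congr
      (f := fun u => (chartAt (EuclideanHalfSpace (n + 1)) p.1).symm (toHalfSpace n u)) ?_ ?_
    · exact (chartAt (EuclideanHalfSpace (n + 1)) p.1).continuousOn_symm.comp
        (continuous_toHalfSpace n).continuousOn fun u hu => hu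
    · intro u hu
      simp only [mem_preimage] at hu
      simp [hu]

/-- `boundaryChart p` is `tail ∘ chartAt p ∘ Subtype.val`. [folklore] -/
@[simp]
theorem boundaryChart_apply (p q : (𝓡∂ (n + 1)).boundary W) :
    boundaryChart p q = tail n (chartAt (EuclideanHalfSpace (n + 1)) p.1 q.1).val := rfl

/-- The source of `boundaryChart p` is `∂W ∩ (chartAt p).source`. [folklore] -/
@[simp]
theorem boundaryChart_source (p : (𝓡∂ (n + 1)).boundary W) :
    (boundaryChart p).source =
      Subtype.val ⁻¹' (chartAt (EuclideanHalfSpace (n + 1)) p.1).source := rfl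

/-- The target of `boundaryChart p` is `{u | (0, u) ∈ (chartAt p).target}`. [folklore] -/
@[simp]
theorem boundaryChart_target (p : (𝓡∂ (n + 1)).boundary W) :
    (boundaryChart p).target =
      toHalfSpace n ⁻¹' (chartAt (EuclideanHalfSpace (n + 1)) p.1).target := rfl

/-- On its target, the inverse of `boundaryChart p` is `u ↦ (chartAt p)⁻¹ (0, u)`. [folklore] -/
theorem coe_boundaryChart_symm_of_mem (p : (𝓡∂ (n + 1)).boundary W) {u : 𝔼 n}
    (hu : toHalfSpace n u ∈ (chartAt (EuclideanHalfSpace (n + 1)) p.1).target) :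
    ((boundaryChart p).symm u).val =
      (chartAt (EuclideanHalfSpace (n + 1)) p.1).symm (toHalfSpace n u) := by
  have : (boundaryChart p).symm u =
      ⟨_, symm_toHalfSpace_mem_boundary (chart_mem_atlas (EuclideanHalfSpace (n + 1)) p.1) hu⟩ :=
    dif_pos hu
  rw [this]

variable (n W) in
/-- **The smooth structure on `∂W`, charts.**  The atlas of the boundary `∂W` (as the subtype
`↥((𝓡∂ (n + 1)).boundary W)` of `W`) consists of the restricted boundary charts
`boundaryChart p`, `p ∈ ∂W`.  Lee, *Introduction to Smooth Manifolds* (2013), Thm 5.11.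
[cite: LeeSmoothManifolds2013, Thm. 5.11] -/
instance chartedSpace : ChartedSpace (𝔼 n) ((𝓡∂ (n + 1)).boundary W) where
  atlas := range (boundaryChart (n := n) (W := W))
  chartAt := boundaryChart
  mem_chart_source p := mem_chart_source (EuclideanHalfSpace (n + 1)) p.1
  chart_mem_atlas p := mem_range_self p

variable (n W) in
/-- **The smooth structure on `∂W`, compatibility.**  The atlas `boundaryChart` of `∂W` is `C^∞`:
its transition maps are `tail ∘ τ ∘ toHalfSpace` for the (extended) transition maps `τ` of `W`.
Lee, *Introduction to Smooth Manifolds* (2013), Thm 5.11.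
[cite: LeeSmoothManifolds2013, Thm. 5.11] -/
instance isManifold : IsManifold (𝓡 n) ∞ ((𝓡∂ (n + 1)).boundary W) := by
  apply isManifold_of_contDiffOn
  rintro e e' ⟨p, rfl⟩ ⟨p', rfl⟩
  have key : ContDiffOn ℝ ∞
      (fun u : 𝔼 n => tail n ((𝓡∂ (n + 1)).extendCoordChange
        (chartAt (EuclideanHalfSpace (n + 1)) p.1) (chartAt (EuclideanHalfSpace (n + 1)) p'.1)
        (consCLE n (u, 0))))
      ((boundaryChart p).target ∩ (boundaryChart p).symm ⁻¹' (boundaryChart p').source) := by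
    refine (contDiff_tail n).comp_contDiffOn (ContDiffOn.comp
      ((𝓡∂ (n + 1)).contDiffOn_extendCoordChange (IsManifold.chart_mem_maximalAtlas p.1)
        (IsManifold.chart_mem_maximalAtlas p'.1))
      (contDiff_consCLE_zero n).contDiffOn ?_)
    rintro u ⟨hu1, hu2⟩
    rw [ModelWithCorners.extendCoordChange_source]
    refine ⟨toHalfSpace n u, ⟨hu1, ?_⟩, rfl⟩
    simp only [mem_preimage, boundaryChart_source] at hu2
    rwa [coe_boundaryChart_symm_of_mem p hu1] at hu2
  simp only [modelWithCornersSelf_coe, modelWithCornersSelf_coe_symm, preimage_id, range_id,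
    inter_univ, Function.comp_id, Function.id_comp]
  rw [OpenPartialHomeomorph.coe_trans, OpenPartialHomeomorph.trans_source,
    OpenPartialHomeomorph.symm_source]
  refine key.congr ?_
  rintro u ⟨hu1, hu2⟩
  simp only [comp_apply, boundaryChart_apply, PartialEquiv.coe_trans,
    OpenPartialHomeomorph.extend_coe, OpenPartialHomeomorph.extend_coe_symm,
    modelWithCorners_symm_consCLE, coe_boundaryChart_symm_of_mem p hu1]
  rfl

/-- **`∂W ↪ W` is a smooth immersion**: in the charts `boundaryChart x` and `chartAt x.1` the
inclusion reads `u ↦ consCLE n (u, 0) = (0, u)`, i.e. the boundary charts of `W` are slice charts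
for `∂W`.  Lee, *Introduction to Smooth Manifolds* (2013), Thm 5.11.
[cite: LeeSmoothManifolds2013, Thm. 5.11] -/
theorem isImmersion_subtype_val :
    Manifold.IsImmersion (𝓡 n) (𝓡∂ (n + 1)) ∞
      (Subtype.val : (𝓡∂ (n + 1)).boundary W → W) := by
  refine Manifold.IsImmersionOfComplement.isImmersion (F := ℝ) fun x => ?_
  refine Manifold.IsImmersionAtOfComplement.mk_of_continuousAt
    continuous_subtype_val.continuousAt (consCLE n) (boundaryChart x)
    (chartAt (EuclideanHalfSpace (n + 1)) x.1) (mem_chart_source _ x.1)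
    (mem_chart_source _ x.1) (IsManifold.chart_mem_maximalAtlas x)
    (IsManifold.chart_mem_maximalAtlas x.1) ?_
  intro u hu
  rw [OpenPartialHomeomorph.extend_target, modelWithCornersSelf_coe_symm, modelWithCornersSelf_coe,
    range_id, inter_univ, preimage_id] at hu
  have hu' : toHalfSpace n u ∈ (chartAt (EuclideanHalfSpace (n + 1)) x.1).target := hu
  simp only [comp_apply, OpenPartialHomeomorph.extend_coe, OpenPartialHomeomorph.extend_coe_symm,
    modelWithCornersSelf_coe_symm, id_eq]
  rw [coe_boundaryChart_symm_of_mem x hu',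
    (chartAt (EuclideanHalfSpace (n + 1)) x.1).right_inv hu']
  rfl

/-- **`∂W ↪ W` is a smooth embedding** (a smooth immersion and a topological embedding).
Lee, *Introduction to Smooth Manifolds* (2013), Thm 5.11.
[cite: LeeSmoothManifolds2013, Thm. 5.11] -/
theorem isSmoothEmbedding_subtype_val :
    Manifold.IsSmoothEmbedding (𝓡 n) (𝓡∂ (n + 1)) ∞
      (Subtype.val : (𝓡∂ (n + 1)).boundary W → W) :=
  ⟨isImmersion_subtype_val, Topology.IsEmbedding.subtypeVal⟩

variable (n W) in
/-- The boundary datum of `W` carried by the subtype `∂W = ↥((𝓡∂ (n + 1)).boundary W)` with its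
restricted-chart smooth structure and the inclusion `Subtype.val`.
Lee, *Introduction to Smooth Manifolds* (2013), Thm 5.11.
[cite: LeeSmoothManifolds2013, Thm. 5.11] -/
def boundaryData : BoundaryData (𝓡∂ (n + 1)) W (𝓡 n) where
  carrier := (𝓡∂ (n + 1)).boundary W
  incl := Subtype.val
  isSmoothEmbedding := isSmoothEmbedding_subtype_val
  range_incl := Subtype.range_val

/-- The carrier of `boundaryData n W` is the subtype `∂W`. [folklore] -/
@[simp]
theorem boundaryData_carrier : (boundaryData n W).carrier = ↥((𝓡∂ (n + 1)).boundary W) := rfl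

/-- The inclusion of `boundaryData n W` is `Subtype.val`. [folklore] -/
@[simp]
theorem boundaryData_incl : (boundaryData n W).incl = Subtype.val := rfl

end charts

end BoundaryManifold

/-- **The boundary of a manifold with boundary is a manifold** (discharge of
`Literature.Topology.FourManifolds.nonempty_boundaryData`): the subtype `∂W` with the restricted boundary charts
(`Literature.Topology.FourManifolds.BoundaryManifold.boundaryData`) is a boundary datum.
Lee, *Introduction to Smooth Manifolds* (2013), Thm 5.11 (with Thm 1.46).
[cite: LeeSmoothManifolds2013, Thm. 5.11] -/
theorem nonempty_boundaryData_holds : nonempty_boundaryData := by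
  intro n W _ _ _ _ _
  exact ⟨BoundaryManifold.boundaryData n W⟩

end Literature.Topology.FourManifolds
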